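import Literature.NumberTheory.Transcendental.EvaluationModuleJumps
import Literature.NumberTheory.LFunctions.LcmUptoCubeBound
import Mathlib.NumberTheory.Chebyshev
import Mathlib.Tactic
import HarnessLib

/-!
# The Siegel step of CDT Lemma 61, I: coefficients of the auxiliary function and their integrality

Calegari–Dimitrov–Tang, arXiv:2408.15403, §6.2 Lemma 61 and §6.3 (p. 50). For power series of the
crude denominator type (6.7)
`f_i(x) = Σ_n a_{i,n} xⁿ / (A^{n+1} [1,…,Bn]^σ)` (`a_{i,n} ∈ ℤ`), the Taylor coefficients
`β_𝐧` of the auxiliary function `F(𝐱) = Σ c_{𝐢,𝐤} 𝐱^𝐤 Π_s f_{i_s}(x_s)` (eq. (6.8)) are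
`ℤ`-linear forms in the unknowns `c_{𝐢,𝐤}` after multiplication by
`Δ_𝐧 = Π_s A^{n_s+1}[1,…,Bn_s]^σ`; this is the integer matrix `𝐀` of the linear system
`𝐀·𝐲 = 0` of the proof of Lemma 61 ("a simple estimate based on the prime number theorem shows
that the system can be expressed into the form `𝐀 · 𝐲 = 0` … with entries bounded by
`C₀(A,B,σ,ρ)^α`", p. 50). This file provides:

* `crudeDen`, `crudeSeries` — the type (6.7); `coeff_tprod_X_pow_mul_crudeSeries` — the
  coefficient of `𝐱^𝐧` in `𝐱^𝐤 Π_s f_{i_s}(x_s)`;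
* `entry` — the integer `Δ_𝐧 · coeff_𝐧(𝐱^𝐤 Π f_{i_s}(x_s))` and `prod_crudeDen_mul_coeff_tprod`
  (integrality, using `[1,…,B(n−k)] ∣ [1,…,Bn]`, the tree's
  `Literature.NumberTheory.LFunctions.lcmUpto_dvd_lcmUpto_of_le`);
* `abs_entry_le` — the height bound `|entry| ≤ ((C₁A)^{L+1} [1,…,BL]^σ)^d` for `n_s ≤ L`,
  `|a_{i,n}| ≤ C₁^{n+1}`; with Chebyshev's `[1,…,N] ≤ e^{(log 4 + 4)N}`
  (`Chebyshev.psi_le_const_mul_self`) this is `e^{O(dL)} = C₀^{O(α)}` (`lcmUpto_le_exp`).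

No named facts.

## References

* [CalegariDimitrovTang2024] arXiv:2408.15403, §6.2 eq. (6.7), (6.8), Lemma 61; §6.3 (p. 50).
-/

noncomputable section

open PowerSeries Finset

namespace Literature.NumberTheory.Transcendental

namespace CalegariDimitrovTang

variable {m d : ℕ}

/-! ### The crude denominator type -/

/-- The crude denominators `A^{n+1} [1,…,Bn]^σ` of eq. (6.7).
[cite: CalegariDimitrovTang2024, §6.2 eq. (6.7)] -/
def crudeDen (A B σ n : ℕ) : ℕ := A ^ (n + 1) * Nat.lcmUpto (B * n) ^ σ

/-- Crude denominators are positive (`A ≥ 1`). [folklore] -/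
theorem crudeDen_pos {A : ℕ} (hA : 0 < A) (B σ n : ℕ) : 0 < crudeDen A B σ n :=
  Nat.mul_pos (pow_pos hA _) (pow_pos (Nat.lcmUpto_pos _) _)

/-- **Chebyshev**: `[1,…,N] ≤ e^{(log 4 + 4) N}` (Mathlib's `Chebyshev.psi_le_const_mul_self` with
`ψ(N) = log [1,…,N]`). [folklore] -/
theorem lcmUpto_le_exp (N : ℕ) : (Nat.lcmUpto N : ℝ) ≤ Real.exp ((Real.log 4 + 4) * N) := by
  have h1 := Chebyshev.psi_eq_log_lcmUpto N
  have h2 := Chebyshev.psi_le_const_mul_self (x := (N : ℝ)) (Nat.cast_nonneg N)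
  have hpos : (0 : ℝ) < Nat.lcmUpto N := by exact_mod_cast Nat.lcmUpto_pos N
  rw [h1] at h2
  calc (Nat.lcmUpto N : ℝ) = Real.exp (Real.log (Nat.lcmUpto N)) := (Real.exp_log hpos).symm
    _ ≤ Real.exp ((Real.log 4 + 4) * N) := Real.exp_le_exp.mpr h2

/-- The power series `Σ_n a_n xⁿ/(A^{n+1}[1,…,Bn]^σ)` of crude type `(A, B, σ)` with integer
numerators `a`. [cite: CalegariDimitrovTang2024, §6.2 eq. (6.7)] -/
def crudeSeries (A B σ : ℕ) (a : ℕ → ℤ) : ℚ⟦X⟧ :=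
  PowerSeries.mk fun n => (a n : ℚ) / crudeDen A B σ n

/-- Coefficients of `x^k · f`. [folklore] -/
theorem coeff_X_pow_mul_crudeSeries (A B σ : ℕ) (a : ℕ → ℤ) (k n : ℕ) :
    coeff n ((X : ℚ⟦X⟧) ^ k * crudeSeries A B σ a) =
      if k ≤ n then (a (n - k) : ℚ) / crudeDen A B σ (n - k) else 0 := by
  rw [PowerSeries.coeff_X_pow_mul', crudeSeries]
  split_ifs with h
  · rw [PowerSeries.coeff_mk]
  · rfl

/-- The coefficient of `𝐱^𝐧` in `𝐱^𝐤 Π_s f_{i_s}(x_s)`. [cite: CalegariDimitrovTang2024, §6.3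
eq. (6.14)] -/
theorem coeff_tprod_X_pow_mul_crudeSeries (A B σ : ℕ) (a : Fin m → ℕ → ℤ) (i : Fin d → Fin m)
    (k : Fin d → ℕ) (n : Fin d →₀ ℕ) :
    MvPowerSeries.coeff n (tprod fun s => (X : ℚ⟦X⟧) ^ (k s) * crudeSeries A B σ (a (i s))) =
      ∏ s, (if k s ≤ n s then (a (i s) (n s - k s) : ℚ) / crudeDen A B σ (n s - k s) else 0) := by
  rw [coeff_tprod]
  exact Finset.prod_congr rfl fun s _ => coeff_X_pow_mul_crudeSeries A B σ (a (i s)) (k s) (n s)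

/-! ### Integrality after clearing `Δ_𝐧 = Π_s A^{n_s+1}[1,…,Bn_s]^σ` -/

/-- The integer entry `Δ_𝐧 · coeff_𝐧(𝐱^𝐤 Π_s f_{i_s}(x_s))` of the matrix of the linear system:
`Π_s a_{i_s, n_s−k_s} A^{k_s} ([1,…,Bn_s]/[1,…,B(n_s−k_s)])^σ` if `𝐤 ≤ 𝐧`, else `0`.
[cite: CalegariDimitrovTang2024, §6.3 (the matrix `𝐀`, p. 50)] -/
def entry (A B σ : ℕ) (a : Fin m → ℕ → ℤ) (i : Fin d → Fin m) (k n : Fin d → ℕ) : ℤ :=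
  if ∀ s, k s ≤ n s then
    ∏ s, a (i s) (n s - k s) * ((A ^ (k s) * (Nat.lcmUpto (B * n s) / Nat.lcmUpto (B * (n s - k s))) ^ σ : ℕ) : ℤ)
  else 0

/-- `Δ_n / Δ_{n−k} = A^k ([1,…,Bn]/[1,…,B(n−k)])^σ` in `ℚ`. [folklore] -/
theorem crudeDen_div {A : ℕ} (hA : 0 < A) (B σ : ℕ) {k n : ℕ} (hkn : k ≤ n) :
    (crudeDen A B σ n : ℚ) / crudeDen A B σ (n - k) =
      ((A ^ k * (Nat.lcmUpto (B * n) / Nat.lcmUpto (B * (n - k))) ^ σ : ℕ) : ℚ) := by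
  have hdvd : Nat.lcmUpto (B * (n - k)) ∣ Nat.lcmUpto (B * n) :=
    Literature.NumberTheory.LFunctions.lcmUpto_dvd_lcmUpto_of_le (Nat.mul_le_mul_left B (Nat.sub_le n k))
  have hL0 : (Nat.lcmUpto (B * (n - k)) : ℚ) ≠ 0 := by exact_mod_cast (Nat.lcmUpto_pos _).ne'
  have hA0 : (A : ℚ) ≠ 0 := by exact_mod_cast hA.ne'
  have hden0 : (crudeDen A B σ (n - k) : ℚ) ≠ 0 := by exact_mod_cast (crudeDen_pos hA B σ (n - k)).ne'
  rw [div_eq_iff hden0]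
  unfold crudeDen
  push_cast
  rw [Nat.cast_div hdvd (by exact_mod_cast (Nat.lcmUpto_pos _).ne')]
  rw [div_pow, show n + 1 = k + (n - k + 1) by omega, pow_add]
  field_simp

/-- **Integrality**: `Δ_𝐧 · coeff_𝐧(𝐱^𝐤 Π_s f_{i_s}(x_s)) = entry ∈ ℤ`.
[cite: CalegariDimitrovTang2024, §6.3 (p. 50)] -/
theorem prod_crudeDen_mul_coeff_tprod {A : ℕ} (hA : 0 < A) (B σ : ℕ) (a : Fin m → ℕ → ℤ)
    (i : Fin d → Fin m) (k : Fin d → ℕ) (n : Fin d →₀ ℕ) :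
    (∏ s, (crudeDen A B σ (n s) : ℚ)) *
        MvPowerSeries.coeff n (tprod fun s => (X : ℚ⟦X⟧) ^ (k s) * crudeSeries A B σ (a (i s))) =
      (entry A B σ a i k n : ℚ) := by
  rw [coeff_tprod_X_pow_mul_crudeSeries, entry]
  split_ifs with hkn
  · rw [Int.cast_prod, ← Finset.prod_mul_distrib]
    refine Finset.prod_congr rfl fun s _ => ?_
    rw [if_pos (hkn s), Int.cast_mul, Int.cast_natCast, mul_div_left_comm, crudeDen_div hA B σ (hkn s)]
  · push Not at hkn
    obtain ⟨s, hs⟩ := hkn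
    have hz : (∏ s, (if k s ≤ n s then (a (i s) (n s - k s) : ℚ) / crudeDen A B σ (n s - k s) else 0)) = 0 :=
      Finset.prod_eq_zero (Finset.mem_univ s) (by rw [if_neg (not_le.mpr hs)])
    rw [hz, mul_zero, Int.cast_zero]

/-- **The linear system**: for `F = Σ_j c_j · 𝐱^{𝐤_j} Π_s f_{i_j(s)}(x_s)` with integer `c_j`,
`Δ_𝐧 · β_𝐧(F) = Σ_j c_j · entry_j(𝐧)` is an integer linear form in `c`.
[cite: CalegariDimitrovTang2024, §6.3 eq. (6.14) and the system `𝐀 · 𝐲 = 0` (p. 50)] -/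
theorem prod_crudeDen_mul_coeff_sum {ι : Type*} [Fintype ι] {A : ℕ} (hA : 0 < A) (B σ : ℕ)
    (a : Fin m → ℕ → ℤ) (i : ι → Fin d → Fin m) (k : ι → Fin d → ℕ) (c : ι → ℤ) (n : Fin d →₀ ℕ) :
    (∏ s, (crudeDen A B σ (n s) : ℚ)) * MvPowerSeries.coeff n
        (∑ j, (c j : ℚ) • tprod fun s => (X : ℚ⟦X⟧) ^ (k j s) * crudeSeries A B σ (a (i j s))) =
      ((∑ j, c j * entry A B σ a (i j) (k j) n : ℤ) : ℚ) := by
  rw [map_sum, Finset.mul_sum, Int.cast_sum]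
  refine Finset.sum_congr rfl fun j _ => ?_
  rw [map_smul, smul_eq_mul, mul_left_comm, prod_crudeDen_mul_coeff_tprod hA, Int.cast_mul]

/-- Hence `β_𝐧(F) = 0 ↔ Σ_j c_j entry_j(𝐧) = 0`: the vanishing conditions on the Taylor
coefficients of `F` are the integer linear equations `𝐀 · 𝐜 = 0`.
[cite: CalegariDimitrovTang2024, §6.3 (p. 50)] -/
theorem coeff_sum_eq_zero_iff {ι : Type*} [Fintype ι] {A : ℕ} (hA : 0 < A) (B σ : ℕ)
    (a : Fin m → ℕ → ℤ) (i : ι → Fin d → Fin m) (k : ι → Fin d → ℕ) (c : ι → ℤ) (n : Fin d →₀ ℕ) :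
    MvPowerSeries.coeff n
        (∑ j, (c j : ℚ) • tprod fun s => (X : ℚ⟦X⟧) ^ (k j s) * crudeSeries A B σ (a (i j s))) = 0 ↔
      ∑ j, c j * entry A B σ a (i j) (k j) n = 0 := by
  have hΔ : (∏ s, (crudeDen A B σ (n s) : ℚ)) ≠ 0 :=
    Finset.prod_ne_zero_iff.mpr fun s _ => by exact_mod_cast (crudeDen_pos hA B σ (n s)).ne'
  have h := prod_crudeDen_mul_coeff_sum hA B σ a i k c n
  constructor
  · intro h0
    rw [h0, mul_zero] at h
    exact_mod_cast h.symm
  · intro h0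
    rw [h0, Int.cast_zero] at h
    exact (mul_eq_zero.mp h).resolve_left hΔ

/-! ### The height bound -/

/-- **Height of the matrix entries**: for `n_s ≤ L`, `|a_{i,n}| ≤ C₁^{n+1}` (`C₁, A ≥ 1`),
`|entry| ≤ ((C₁A)^{L+1} [1,…,BL]^σ)^d`. [cite: CalegariDimitrovTang2024, §6.3 ("entries bounded
in absolute value by `C₀(A,B,σ,ρ)^α`", p. 50)] -/
theorem abs_entry_le {A C₁ : ℕ} (hA : 0 < A) (hC₁ : 0 < C₁) (B σ : ℕ) {a : Fin m → ℕ → ℤ}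
    (ha : ∀ i n, |a i n| ≤ (C₁ : ℤ) ^ (n + 1)) (i : Fin d → Fin m) (k n : Fin d → ℕ) {L : ℕ}
    (hn : ∀ s, n s ≤ L) :
    |entry A B σ a i k n| ≤ ((((C₁ * A) ^ (L + 1) * Nat.lcmUpto (B * L) ^ σ : ℕ) : ℤ)) ^ d := by
  unfold entry
  split_ifs with hkn
  · rw [Finset.abs_prod]
    calc ∏ s, |a (i s) (n s - k s) * ((A ^ (k s) * (Nat.lcmUpto (B * n s) / Nat.lcmUpto (B * (n s - k s))) ^ σ : ℕ) : ℤ)|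
        ≤ ∏ _s : Fin d, ((((C₁ * A) ^ (L + 1) * Nat.lcmUpto (B * L) ^ σ : ℕ) : ℤ)) := by
          refine Finset.prod_le_prod (fun s _ => abs_nonneg _) fun s _ => ?_
          rw [abs_mul, Nat.abs_cast]
          have h1 : |a (i s) (n s - k s)| ≤ (C₁ : ℤ) ^ (L + 1) :=
            (ha _ _).trans (pow_le_pow_right₀ (by exact_mod_cast hC₁) (by have := hn s; omega))
          have h2 : (A ^ (k s) * (Nat.lcmUpto (B * n s) / Nat.lcmUpto (B * (n s - k s))) ^ σ : ℕ) ≤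
              A ^ (L + 1) * Nat.lcmUpto (B * L) ^ σ := by
            refine Nat.mul_le_mul (Nat.pow_le_pow_right hA (by have := hn s; have := hkn s; omega)) ?_
            refine Nat.pow_le_pow_left ((Nat.div_le_self _ _).trans
              (Literature.NumberTheory.LFunctions.lcmUpto_le_lcmUpto_of_le ?_)) σ
            exact Nat.mul_le_mul_left B (hn s)
          calc |a (i s) (n s - k s)| * ((A ^ (k s) * (Nat.lcmUpto (B * n s) / Nat.lcmUpto (B * (n s - k s))) ^ σ : ℕ) : ℤ)
              ≤ (C₁ : ℤ) ^ (L + 1) * ((A ^ (L + 1) * Nat.lcmUpto (B * L) ^ σ : ℕ) : ℤ) := by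
                refine mul_le_mul h1 (by exact_mod_cast h2) (by positivity) (by positivity)
            _ = ((((C₁ * A) ^ (L + 1) * Nat.lcmUpto (B * L) ^ σ : ℕ) : ℤ)) := by push_cast; ring
      _ = _ := by rw [Finset.prod_const, Finset.card_univ, Fintype.card_fin]
  · rw [abs_zero]
    positivity

end CalegariDimitrovTang

end Literature.NumberTheory.Transcendental
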